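import Mathlib
import HarnessLib
import Summits.HubbardSuperconductivity.HubbardSuperconductivity.Theorems.KLProgrammeKLRegimeEngineV8DefsU4
import Summits.HubbardSuperconductivity.HubbardSuperconductivity.Theorems.KLProgrammeKLRegimeSplitBundleV16

/-!
# K3 GEN-6 engine child (`KLRegimeEngineV16`, skeleton V16-G5-U4), stub `stub_engine_step_values`: what is LEFT after the value-clause reductions —
# the five-clause conclusion from (E2-v10), the OUT-OF-CLASS half of (E2″-v7), (E4) and (E5-S), under EXACTLY the stub's binders
# (cell gate-hubbard-kl, seat hubbard-kl-k3c2-p2 g6; value-clause reduction lane `klvr_/klvr9_/klvr10_/klvr11_`)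

The registered (XL) stub concludes `PairLadderStepAtV10 … n ∧ PairValueIncrementAtV7 … n ∧ QuarticValueIncrementAtS4 … n ∧ EngineFirstMoments … n ∧
IsoTupleL1AtS … n` at `(klEngGeo5, klEngQ5 P R)` from the binders `P.WF, R.WF2, 0 < c ≤ klEngC₃3, μ ∈ klWindowC, 0 < U ≤ klEngU₀4 P R c, klBetaMin ≤ β ≤
exp(c/U²), FrameOK …, klEngL₃ ≤ L, klEngM₃ ≤ M, 1 ≤ n ≤ nScales β + 1, IsKLRegime, HistP klPredsV16 … n, KernelNormsV4 … n`.  With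
`klvr11_quarticValueIncrementAtS4_of_pairValueIncrementAtV7` ((E2′-S4) ⇐ (E2″-v7)) and `klvr11_pairValueIncrement_inClass_klEng` (in-class (E2″-v7) ⇐
(E2-v10) + the history's `BetaSplitAtS2 … (n−1)` under `U ≤ klEngU₀4`, `…EngineV8DefsU4`), the stub's owed content is EXACTLY:

* (E2-v10) `PairLadderStepAtV10 … n` (the one-step ladder identity with the (T)/(D)/(X) remainder — the expansion);
* the OUT-OF-CLASS half of (E2″-v7): the increment inequality at the total momenta `Qm` with `¬ IsPairClassAt L Qm n` (`|Qm|_𝕋 > 4^{-n}`, where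
  (E2-v10) is silent and the two-shell pp gain `klEngGeo5.ppGain n |Qm|_𝕋` carries the bound);
* (E4) `EngineFirstMoments … n` and (E5-S) `IsoTupleL1AtS … n`.

`klvr16_pairValueIncrementAtV7_of_inClass_outClass` (case split), `klvr16_pairValueIncrementAtV7_klEng` ((E2″-v7) from (E2-v10) + history + out-of-class
half), **`klvr16_stepValues_of_reduced`** (the stub's literal conclusion from the four owed pieces, under its literal binders; `R.WF2` is read only as `R.WF`).
Bookkeeping over the route's predicates and the package; nothing about the model is asserted; no new definitions.
-/

noncomputable section

namespace Summit.HubbardSuperconductivity.HubbardSuperconductivity.Theorems.EngineV8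

set_option linter.dupNamespace false -- summit = problem name (single-conjunct summit), D-0017

open Real Finset Literature.MathematicalPhysics.QuantumLattice Literature.Probability.LatticeModels
open Summit.HubbardSuperconductivity.HubbardSuperconductivity.Theorems.KLRegimeSplit
open Summit.HubbardSuperconductivity.HubbardSuperconductivity.Theorems.KLProgrammeLegKernels
open Summit.HubbardSuperconductivity.HubbardSuperconductivity.Theorems.DispersionFlow

section Model

variable {L M : ℕ} [NeZero L] [NeZero M]

/-- **(E2″-v7) by cases on the pair class**: the in-class and the out-of-class halves of the increment inequality give `PairValueIncrementAtV7 … n`. -/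
theorem klvr16_pairValueIncrementAtV7_of_inClass_outClass {G : GeoConsts} {P : SplitConsts} {Q : EngConsts} {β U μ : ℝ} {K : TrigPolyC4v}
    {n : ℕ}
    (hin : ∀ Qm : TorusSite 2 L, IsPairClassAt L Qm n → ∀ k ∈ klBall L μ K, ∀ k' ∈ klBall L μ K,
      ‖klPairAmplitude L M β U μ K n Qm k k' - klPairAmplitude L M β U μ K (n - 1) Qm k k'‖ ≤
        gainBar G P U n (klTorusNorm L Qm) (klTorusNorm L (k - k')) (klTorusNorm L (k + k' - Qm)) +
          eremBar G P Q U β L (n - 1) + thermalBar G P U β n +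
            legDressBarQ2 G P Q U n (legSliceCountT L β μ K n ![k', Qm - k', Qm - k, k]))
    (hout : ∀ Qm : TorusSite 2 L, ¬ IsPairClassAt L Qm n → ∀ k ∈ klBall L μ K, ∀ k' ∈ klBall L μ K,
      ‖klPairAmplitude L M β U μ K n Qm k k' - klPairAmplitude L M β U μ K (n - 1) Qm k k'‖ ≤
        gainBar G P U n (klTorusNorm L Qm) (klTorusNorm L (k - k')) (klTorusNorm L (k + k' - Qm)) +
          eremBar G P Q U β L (n - 1) + thermalBar G P U β n +
            legDressBarQ2 G P Q U n (legSliceCountT L β μ K n ![k', Qm - k', Qm - k, k])) :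
    PairValueIncrementAtV7 L M G P Q β U μ K n := by
  intro _hn Qm k hk k' hk'
  by_cases hQm : IsPairClassAt L Qm n
  · exact hin Qm hQm k hk k' hk'
  · exact hout Qm hQm k hk k' hk'

/-- **(E2″-v7) at the gen-6 package from (E2-v10), the history and the OUT-OF-CLASS half** (`P.WF`, `R.WF`, `0 < U ≤ klEngU₀4 P R c`, `1 ≤ n`,
`HistP klPredsV16 … n` — read only through `BetaSplitAtS2 … (n−1)`). -/
theorem klvr16_pairValueIncrementAtV7_klEng {P : SplitConsts} (hP : P.WF) {R : RenConsts} (hR : R.WF) {c β U μ : ℝ} (hU : 0 < U)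
    (hU₀ : U ≤ klEngU₀4 P R c) {K : TrigPolyC4v} {n : ℕ} (hn : 1 ≤ n)
    (hhist : HistP klPredsV16 L M klEngGeo5 P (klEngQ5 P R) R β U μ K n)
    (hlad : PairLadderStepAtV10 L M klEngGeo5 P (klEngQ5 P R) β U μ K n)
    (hout : ∀ Qm : TorusSite 2 L, ¬ IsPairClassAt L Qm n → ∀ k ∈ klBall L μ K, ∀ k' ∈ klBall L μ K,
      ‖klPairAmplitude L M β U μ K n Qm k k' - klPairAmplitude L M β U μ K (n - 1) Qm k k'‖ ≤
        gainBar klEngGeo5 P U n (klTorusNorm L Qm) (klTorusNorm L (k - k')) (klTorusNorm L (k + k' - Qm)) +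
          eremBar klEngGeo5 P (klEngQ5 P R) U β L (n - 1) + thermalBar klEngGeo5 P U β n +
            legDressBarQ2 klEngGeo5 P (klEngQ5 P R) U n (legSliceCountT L β μ K n ![k', Qm - k', Qm - k, k])) :
    PairValueIncrementAtV7 L M klEngGeo5 P (klEngQ5 P R) β U μ K n := by
  have hsplit : BetaSplitAtS2 L M klEngGeo5 P (klEngQ5 P R) β U μ K (n - 1) := (histP_V16_apply hhist (by omega)).1
  exact klvr16_pairValueIncrementAtV7_of_inClass_outClass
    (fun Qm hQm => klvr11_pairValueIncrement_inClass_klEng_of_split hP hR hU hU₀ hn hlad hsplit hQm) hout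

/-- **`stub_engine_step_values` (V16-G5-U4) from its four owed pieces, under its LITERAL binders**: (E2-v10) at `n`, the OUT-OF-CLASS half of
(E2″-v7) at `n`, (E4) at `n`, (E5-S) at `n` ⇒ the registered five-clause conclusion.  (The binders `c ≤ klEngC₃3`, `μ ∈ klWindowC`, `β`-range,
`FrameOK`, volume thresholds, `IsKLRegime`, `KernelNormsV4 … n` are carried for shape parity and not read here.) -/
theorem klvr16_stepValues_of_reduced (P : SplitConsts) (R : RenConsts) (c : ℝ) (hP : P.WF) (hR : R.WF2) (_hc : 0 < c)
    (_hc3 : c ≤ klEngC₃3 P R) (μ : ℝ) (_hμ : μ ∈ klWindowC) (U : ℝ) (hU : 0 < U) (hUle : U ≤ klEngU₀4 P R c) (β : ℝ)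
    (_hβ : klBetaMin ≤ β) (_hβc : β ≤ Real.exp (c / U ^ 2)) (K : TrigPolyC4v) (_hK : FrameOK R U (nScales β) μ K)
    (L M : ℕ) [NeZero L] [NeZero M] (_hL : klEngL₃ β U ≤ L) (_hM : klEngM₃ β U L ≤ M) (n : ℕ) (hn : 1 ≤ n)
    (_hnle : n ≤ nScales β + 1) (_hreg : IsKLRegime U c (-(n : ℤ)))
    (hhist : HistP klPredsV16 L M klEngGeo5 P (klEngQ5 P R) R β U μ K n)
    (_hE1 : KernelNormsV4 L M P (klEngQ5 P R) β U μ K n)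
    (hlad : PairLadderStepAtV10 L M klEngGeo5 P (klEngQ5 P R) β U μ K n)
    (hout : ∀ Qm : TorusSite 2 L, ¬ IsPairClassAt L Qm n → ∀ k ∈ klBall L μ K, ∀ k' ∈ klBall L μ K,
      ‖klPairAmplitude L M β U μ K n Qm k k' - klPairAmplitude L M β U μ K (n - 1) Qm k k'‖ ≤
        gainBar klEngGeo5 P U n (klTorusNorm L Qm) (klTorusNorm L (k - k')) (klTorusNorm L (k + k' - Qm)) +
          eremBar klEngGeo5 P (klEngQ5 P R) U β L (n - 1) + thermalBar klEngGeo5 P U β n +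
            legDressBarQ2 klEngGeo5 P (klEngQ5 P R) U n (legSliceCountT L β μ K n ![k', Qm - k', Qm - k, k]))
    (hE4 : EngineFirstMoments L M klEngGeo5 P (klEngQ5 P R) β U μ K n) (hE5 : IsoTupleL1AtS L M klEngGeo5 P β U μ K n) :
    PairLadderStepAtV10 L M klEngGeo5 P (klEngQ5 P R) β U μ K n ∧
      PairValueIncrementAtV7 L M klEngGeo5 P (klEngQ5 P R) β U μ K n ∧
        QuarticValueIncrementAtS4 L M klEngGeo5 P (klEngQ5 P R) β U μ K n ∧
          EngineFirstMoments L M klEngGeo5 P (klEngQ5 P R) β U μ K n ∧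
            IsoTupleL1AtS L M klEngGeo5 P β U μ K n :=
  klvr11_stepValuesConj_of_reduced hlad (klvr16_pairValueIncrementAtV7_klEng hP hR.wf hU hUle hn hhist hlad hout) hE4 hE5

end Model

end Summit.HubbardSuperconductivity.HubbardSuperconductivity.Theorems.EngineV8

end
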